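import Summits.AtomisticToContinuum.Crystallization.Theorems.ReggeStarCoercivityDefectFreeCrystallizesPalmDefs
import Literature.Geometry.DiscreteGeometry.KissingPatterns
import HarnessLib

/-!
# Twelve neighbours of a good root (stub T4 `stub_twelveNeighbours` of line `palm-good-law`,
# crux `ReggeStarCoercivity.DefectFreeCrystallizes`, stmt-AtomisticToContinuum-13603)

**Theorem** (`stub_twelveNeighbours`).  If the root `0` of a point set `S ⊆ ℝ³` is `SetGood`
(for some scale `a ∈ [9/10, 11/10]` the rescaled punctured open `6/5`-neighbourhood
`a⁻¹ • {z ∈ S | z ≠ 0, dist z 0 < 6/5}` is a finite set `1/20`-close to the fcc or the hcp kissing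
pattern), then the counting measure restricted to `S` gives mass exactly `12` to the punctured open
ball `{y | 0 < ‖y‖ < 6/5}`.

**Proof.**  The matched finite set `T` has `12` points (`card_eq_twelve_of_shellCloseTo`).  The
rescaling `z ↦ a⁻¹ • (z - 0)` is injective (`a ≠ 0`), so the punctured neighbourhood
`A = {z ∈ S | z ≠ 0, dist z 0 < 6/5}` is finite with `A.ncard = T.card = 12`; and
`A = {y | 0 < ‖y‖ ∧ ‖y‖ < 6/5} ∩ S` (`dist z 0 = ‖z‖`, `z ≠ 0 ↔ 0 < ‖z‖`), a measurable set
intersected with `S`, so `count|S {y | 0 < ‖y‖ < 6/5} = count A = 12`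
(`Measure.restrict_apply`, `Measure.count_apply_finite`).  All `[folklore]`.
-/

noncomputable section

open MeasureTheory
open scoped ENNReal

namespace Summit.AtomisticToContinuum.Crystallization.Theorems.PalmGoodLaw.TwelveNeighbours

open Literature.Geometry.DiscreteGeometry

/-- **stub_twelveNeighbours** (T4 of line `palm-good-law`): if the root `0` of `S` is `SetGood` (its
punctured open `6/5`-neighbourhood, rescaled by an admissible `a⁻¹`, is `1/20`-close to the fcc or hcp
kissing pattern), then `count|S` gives mass exactly `12` to the punctured open ball `{0 < ‖y‖ < 6/5}`:
the matched set has twelve points (`card_eq_twelve_of_shellCloseTo`), the rescaling `z ↦ a⁻¹ • z` is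
injective, and the punctured ball meets `S` in exactly the rescaled set's preimage
(`Measure.count_apply_finite`). [folklore] -/
theorem stub_twelveNeighbours :
    ∀ S : Set (EuclideanSpace ℝ (Fin 3)), SetGood S 0 →
      (Measure.count : Measure (EuclideanSpace ℝ (Fin 3))).restrict S
        {y : EuclideanSpace ℝ (Fin 3) | 0 < ‖y‖ ∧ ‖y‖ < 6 / 5} = 12 := by
  intro S hS
  obtain ⟨a, ha₁, -, T, hT, hclose⟩ := hS
  have hcard : T.card = 12 := card_eq_twelve_of_shellCloseTo hclose
  have ha : a ≠ 0 := by
    intro h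
    rw [h] at ha₁
    norm_num at ha₁
  have hmeas : MeasurableSet {y : EuclideanSpace ℝ (Fin 3) | 0 < ‖y‖ ∧ ‖y‖ < 6 / 5} :=
    (measurableSet_lt measurable_const measurable_norm).inter
      (measurableSet_lt measurable_norm measurable_const)
  -- the punctured neighbourhood of the root, as in `SetGood S 0`
  set A : Set (EuclideanSpace ℝ (Fin 3)) :=
    {z : EuclideanSpace ℝ (Fin 3) | z ∈ S ∧ z ≠ 0 ∧ dist z 0 < 6 / 5} with hA_def
  have hAeq : {y : EuclideanSpace ℝ (Fin 3) | 0 < ‖y‖ ∧ ‖y‖ < 6 / 5} ∩ S = A := by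
    ext z
    simp only [hA_def, Set.mem_inter_iff, Set.mem_setOf_eq, dist_zero_right, norm_pos_iff]
    tauto
  have hinj : Function.Injective (fun z : EuclideanSpace ℝ (Fin 3) => a⁻¹ • (z - 0)) := by
    intro z w hzw
    have h := smul_right_injective (EuclideanSpace ℝ (Fin 3)) (inv_ne_zero ha) hzw
    simpa using h
  have hfin : A.Finite := by
    have himg : ((fun z : EuclideanSpace ℝ (Fin 3) => a⁻¹ • (z - 0)) '' A).Finite := by
      rw [← hT]
      exact T.finite_toSet
    exact himg.of_finite_image hinj.injOn
  have hncard : A.ncard = 12 := by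
    have h := Set.ncard_image_of_injective A hinj
    rw [← hT, Set.ncard_coe_finset, hcard] at h
    exact h.symm
  rw [Measure.restrict_apply hmeas, hAeq, Measure.count_apply_finite A hfin,
    ← Set.ncard_eq_toFinset_card A hfin, hncard]
  norm_num

end Summit.AtomisticToContinuum.Crystallization.Theorems.PalmGoodLaw.TwelveNeighbours

end
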